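import Summits.QuantumFields.BalabanUV.Beta.GAN24.WoodburyFibreZeroModeGain

/-!
# GAN24 / WoodburyFibreZeroModeGainKInv — the zero-mode gain INSTANTIATED on the field–field block `blockFF (KInv N)` of an2's packed
# one-step resolvent: zero straight-contour sums on both legs, one- and two-sided gains
# (census row V14 of `HOME/b2b-balaban-gan24-p3/WOODBURY-FIBRE.md` v8, companion of `GAN24/WoodburyFibreZeroModeGain`; binder row G-an2-4 ∕ (CONV-C), P3, gen 8)

Cell `pub-balaban`, β sub-cell.  HONEST FRAMING (verbatim): discharging `BetaPertH` makes Bałaban's UV stability UNCONDITIONAL — a real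
constructive-QFT result; it is NOT the continuum limit and NOT the Clay problem.  HONEST DEPENDENCY (verbatim): continuum YM on T⁴ ⇐
BetaPertH ∧ nine spine estimates (0/9 proved); BetaPertH ⇐ (D1) ∧ (D4) ∧ CAP+tail; G-an2-4 gates asym, D1 and NE2/3/4.  NOT IN PRINT; OUR
BOOKKEEPING.  [folklore] over an2's `OneStepResolventKernel.KInv` (`KInv_inl_inl`, `KInv_inl_inl_symm`), pv∕an1's `KKTFluctuationKernel.Gam_Q`
(«every `Γ`-column is a fluctuation field»: zero straight-contour sums) and gen 2's `WoodburyFibreBlocks.blockFF` BY NAME; cites nothing, mints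
no `def … : Prop`, instantiates no wall binder; every `Decays` constant of `Γ^{ff}` is a HYPOTHESIS (per `N` from `decays_KInv`, or the consumer's
uniform one in its own units) — no `N`-uniformity is claimed here.  Discharges NOTHING of (CONV-C), the W-slot, «T2Shape», (D1); NEVER
«G-an2-4 closed»; NOT BetaPertH, NOT continuum, NOT Clay.

## Contents (all [folklore]; `Γ^{ff} := blockFF (KInv N)`)
* `blockFF_inr_right` ∕ `blockFF_inr_left` (no multiplier columns ∕ rows), `decays_blockFF`;
* **`contourSum_blockFF_KInv_left`** (`Q·Γ = 0`: zero contour sums of every field column in the first variable, = `Gam_Q`) and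
  **`contourSum_blockFF_KInv_right`** (`Γ·Qᵀ = 0`, by `KInv_inl_inl_symm`);
* **`decays_comp_ffKInv_right`**: `Decays Γ^{ff} C_Γ δ`, `Bdd J`, `Decays (J − contourRef N J) ω δ` ⇒ `Decays (Γ^{ff} ∘ J) (|Fib d|·C_Γ·ω·Zl(δ−δ′)) δ′`;
  **`decays_comp_ffKInv_left`** (mirror); `l1_resample_le`, `decays_contourRef` ∕ `decays_contourRefL` (qualitative tameness of the references);
  **`decays_comp_comp_ffKInv`**: the TWO-SIDED double gain `|Fib d|²·ω_A·C_Γ·ω_B·Zl(δ−δ′)·Zl(δ′−δ″)` for `A ∘ Γ^{ff} ∘ B`.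
-/

noncomputable section

open Finset
open scoped BigOperators
open Literature.MathematicalPhysics.QuantumFieldTheory
open Literature.MathematicalPhysics.QuantumFieldTheory.Balaban1983to89
open Literature.MathematicalPhysics.QuantumFieldTheory.Balaban1983to89.Beta
open B12Sec2to5 (l1 l1_nonneg)
open ExpKernelCalculus (MKer Decays comp Zl)
open KernelWard (Bdd bdd_of_decays)
open Summit.QuantumFields.BalabanUV.Beta.TameKernelCalculus (Spr)
open AffineAveraging (contourSum unitVec)
open LatticeForm (quo)
open OneStepResolventKernel (Fib KInv KInv_inl_inl KInv_inl_inl_symm l1_zsmul_sub_le)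
open KKTFluctuationKernel (Gam Gam_Q)
open Summit.QuantumFields.BalabanUV.Beta.GAN24.WoodburyFibreBlocks (blockFF)
open Summit.QuantumFields.BalabanUV.Beta.GAN24.WoodburyFibreZeroModeGain

namespace Summit.QuantumFields.BalabanUV.Beta.GAN24.WoodburyFibreZeroModeGainKInv

section Instance

variable {d : ℕ} {N : ℕ} [NeZero N]

/-- `blockFF` has no multiplier columns. [folklore] -/
theorem blockFF_inr_right (K : MKer (d + 1) (Fib d)) (x y : Fin (d + 1) → ℤ) (a : Fib d) (κ : Fin (d + 1)) :
    blockFF K x y a (Sum.inr κ) = 0 := by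
  cases a <;> rfl

/-- `blockFF` has no multiplier rows. [folklore] -/
theorem blockFF_inr_left (K : MKer (d + 1) (Fib d)) (x y : Fin (d + 1) → ℤ) (κ : Fin (d + 1)) (b : Fib d) :
    blockFF K x y (Sum.inr κ) b = 0 := by
  cases b <;> rfl

/-- `blockFF` inherits every `Decays` bound of the kernel. [folklore] -/
theorem decays_blockFF {K : MKer (d + 1) (Fib d)} {C δ : ℝ} (hK : Decays K C δ) : Decays (blockFF K) C δ := by
  intro x y a b
  have hC : 0 ≤ C * Real.exp (-δ * l1 (x - y)) := (abs_nonneg _).trans (hK x y a b)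
  rcases a with κ | κ <;> rcases b with l | l
  · exact hK x y _ _
  all_goals simpa [blockFF] using hC

/-- **LEFT ZERO MODES of `Γ_N^{ff}`**: every field column of `blockFF (KInv N)` has zero straight-contour sums in its first variable
(`KKTFluctuationKernel.Gam_Q`: each `Γ`-column is a fluctuation field, `Q·Γ = 0`). [folklore] -/
theorem contourSum_blockFF_KInv_left (z : Fin (d + 1) → ℤ) (b : Fib d) (κ : Fin (d + 1)) (u : Fin (d + 1) → ℤ) :
    contourSum N (fun κ' y => blockFF (KInv (N := N) (d := d)) y z (Sum.inl κ') b) κ u = 0 := by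
  cases b with
  | inl l =>
      have h := Gam_Q (N := N) (d := d) l z κ u
      simpa only [blockFF, KInv_inl_inl] using h
  | inr l =>
      simp only [blockFF, contourSum, Finset.sum_const_zero]

/-- **RIGHT ZERO MODES of `Γ_N^{ff}`**: every field row of `blockFF (KInv N)` has zero straight-contour sums in its second variable
(`Gam_Q` + the symmetry `KInv_inl_inl_symm`, i.e. `Γ·Qᵀ = 0`). [folklore] -/
theorem contourSum_blockFF_KInv_right (x : Fin (d + 1) → ℤ) (a : Fib d) (κ : Fin (d + 1)) (u : Fin (d + 1) → ℤ) :
    contourSum N (fun κ' y => blockFF (KInv (N := N) (d := d)) x y a (Sum.inl κ')) κ u = 0 := by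
  cases a with
  | inl l =>
      have h := Gam_Q (N := N) (d := d) l x κ u
      have e : (fun κ' y => blockFF (KInv (N := N) (d := d)) x y (Sum.inl l) (Sum.inl κ')) = fun κ' y => Gam (N := N) κ' y l x := by
        funext κ' y
        simp only [blockFF, KInv_inl_inl_symm l κ' x y, KInv_inl_inl]
      rw [e]; exact h
  | inr l =>
      simp only [blockFF, contourSum, Finset.sum_const_zero]

/-- **ONE-SIDED GAIN FOR `Γ_N^{ff}` (right leg)**: for any `Decays` bound `(C_Γ, δ)` of `blockFF (KInv N)` and any bounded right leg `J`
whose field rows oscillate by `ω` over the `N`-contours (`Decays (J − contourRef N J) ω δ`),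
`Decays (Γ^{ff} ∘ J) (|Fib d|·C_Γ·ω·Zl(δ−δ′)) δ′`. [folklore] -/
theorem decays_comp_ffKInv_right {J : MKer (d + 1) (Fib d)} {CΓ ω δ δ' B : ℝ} (hΓ : Decays (blockFF (KInv (N := N) (d := d))) CΓ δ)
    (hδ : 0 < δ) (hJ : Bdd J B) (hω : Decays (J - contourRef N J) ω δ) (hδ'0 : 0 ≤ δ') (hδ' : δ' < δ) :
    Decays (comp (blockFF (KInv (N := N) (d := d))) J) ((Fintype.card (Fib d) : ℝ) * (CΓ * ω) * Zl (d + 1) (δ - δ')) δ' :=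
  decays_comp_of_contourSum_eq_zero hΓ hδ hJ (fun x y a κ => blockFF_inr_right _ x y a κ)
    (fun x a κ u => contourSum_blockFF_KInv_right x a κ u) hω hδ'0 hδ'

/-- **ONE-SIDED GAIN FOR `Γ_N^{ff}` (left leg)**. [folklore] -/
theorem decays_comp_ffKInv_left {A : MKer (d + 1) (Fib d)} {CΓ ω δ δ' B : ℝ} (hA : Bdd A B)
    (hΓ : Decays (blockFF (KInv (N := N) (d := d))) CΓ δ) (hδ : 0 < δ) (hω : Decays (A - contourRefL N A) ω δ)
    (hδ'0 : 0 ≤ δ') (hδ' : δ' < δ) :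
    Decays (comp A (blockFF (KInv (N := N) (d := d)))) ((Fintype.card (Fib d) : ℝ) * (ω * CΓ) * Zl (d + 1) (δ - δ')) δ' :=
  decays_comp_of_contourSum_eq_zero_left hA hΓ hδ (fun y z κ b => blockFF_inr_left _ y z κ b)
    (fun z b κ u => contourSum_blockFF_KInv_left z b κ u) hω hδ'0 hδ'

/-- A coarse re-sampling point of the contour quasi-interpolant lies within `ℓ¹`-distance `N(d+2)` of the fine point. [folklore] -/
theorem l1_resample_le (y : Fin (d + 1) → ℤ) (κ : Fin (d + 1)) {s : ℕ} (hs : s ∈ Finset.range N) :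
    l1 ((N : ℤ) • quo N (y - (s : ℤ) • unitVec κ) - y) ≤ (N : ℝ) * (d + 2) := by
  set w := y - (s : ℤ) • unitVec κ with hw
  have h1 : l1 ((N : ℤ) • quo N w - w) ≤ (N : ℝ) * (d + 1) := by
    have := l1_zsmul_sub_le (N := N) (d := d) (quo N w) w
    simp only [sub_self, l1, Pi.zero_apply, Int.cast_zero, abs_zero, Finset.sum_const_zero, mul_zero, zero_add] at this
    exact this
  have h2 : l1 (w - y) ≤ N := by
    have hsN : (s : ℝ) < N := by exact_mod_cast Finset.mem_range.mp hs
    have : l1 (w - y) = s := by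
      rw [hw, show y - (s : ℤ) • unitVec κ - y = -((s : ℤ) • unitVec κ) by abel]
      simp only [l1, Pi.neg_apply, Pi.smul_apply, AffineAveraging.unitVec_apply, smul_eq_mul, Int.cast_neg, abs_neg]
      rw [Finset.sum_eq_single κ (fun j _ hj => by simp [hj]) (fun h => (h (Finset.mem_univ κ)).elim)]
      simp
    rw [this]; exact hsN.le
  calc l1 ((N : ℤ) • quo N w - y) ≤ l1 ((N : ℤ) • quo N w - w) + l1 (w - y) := ExpKernelCalculus.l1_sub_triangle _ _ _
    _ ≤ (N : ℝ) * (d + 1) + N := add_le_add h1 h2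
    _ = (N : ℝ) * (d + 2) := by ring

/-- The contour quasi-interpolant of a decaying right leg decays (same rate, constant `× e^{δN(d+2)}`; qualitative — it only feeds the
tameness needed for re-association). [folklore] -/
theorem decays_contourRef {J : MKer (d + 1) (Fib d)} {C δ : ℝ} (hJ : Decays J C δ) (hC : 0 ≤ C) (hδ : 0 ≤ δ) :
    Decays (contourRef N J) (C * Real.exp (δ * ((N : ℝ) * (d + 2)))) δ := by
  intro y z f b
  have hmono : C * Real.exp (-δ * l1 (y - z)) ≤ C * Real.exp (δ * ((N : ℝ) * (d + 2))) * Real.exp (-δ * l1 (y - z)) := by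
    rw [mul_assoc]
    refine mul_le_mul_of_nonneg_left (le_mul_of_one_le_left (Real.exp_pos _).le (Real.one_le_exp (by positivity))) hC
  cases f with
  | inr κ => exact (hJ y z _ b).trans hmono
  | inl κ =>
      refine abs_avg_le fun s hs => ?_
      refine (hJ _ z _ b).trans ?_
      rw [mul_assoc, ← Real.exp_add]
      refine mul_le_mul_of_nonneg_left (Real.exp_le_exp.mpr ?_) hC
      have ht := ExpKernelCalculus.l1_sub_triangle y ((N : ℤ) • quo N (y - (s : ℤ) • unitVec κ)) z
      rw [ExpKernelCalculus.l1_sub_symm y ((N : ℤ) • quo N (y - (s : ℤ) • unitVec κ))] at ht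
      have hr := l1_resample_le (N := N) y κ hs
      have h3 : δ * l1 (y - z) ≤ δ * ((N : ℝ) * (d + 2) + l1 ((N : ℤ) • quo N (y - (s : ℤ) • unitVec κ) - z)) :=
        mul_le_mul_of_nonneg_left (by linarith) hδ
      linarith

/-- The contour quasi-interpolant of a decaying left leg decays (same rate, constant `× e^{δN(d+2)}`; qualitative). [folklore] -/
theorem decays_contourRefL {A : MKer (d + 1) (Fib d)} {C δ : ℝ} (hA : Decays A C δ) (hC : 0 ≤ C) (hδ : 0 ≤ δ) :
    Decays (contourRefL N A) (C * Real.exp (δ * ((N : ℝ) * (d + 2)))) δ := by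
  intro x y a f
  have hmono : C * Real.exp (-δ * l1 (x - y)) ≤ C * Real.exp (δ * ((N : ℝ) * (d + 2))) * Real.exp (-δ * l1 (x - y)) := by
    rw [mul_assoc]
    refine mul_le_mul_of_nonneg_left (le_mul_of_one_le_left (Real.exp_pos _).le (Real.one_le_exp (by positivity))) hC
  cases f with
  | inr κ => exact (hA x y a _).trans hmono
  | inl κ =>
      refine abs_avg_le fun s hs => ?_
      refine (hA x _ a _).trans ?_
      rw [mul_assoc, ← Real.exp_add]
      refine mul_le_mul_of_nonneg_left (Real.exp_le_exp.mpr ?_) hC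
      have ht := ExpKernelCalculus.l1_sub_triangle x ((N : ℤ) • quo N (y - (s : ℤ) • unitVec κ)) y
      have hr := l1_resample_le (N := N) y κ hs
      have h3 : δ * l1 (x - y) ≤ δ * (l1 (x - (N : ℤ) • quo N (y - (s : ℤ) • unitVec κ)) + (N : ℝ) * (d + 2)) :=
        mul_le_mul_of_nonneg_left (by linarith) hδ
      linarith

/-- **TWO-SIDED GAIN FOR `Γ_N^{ff}`**: a left leg `A` and a right leg `B`, both decaying at rate `δ` and oscillating by `ω_A`, `ω_B` over
the `N`-contours, sandwiching `blockFF (KInv N)` with any `Decays` bound `(C_Γ, δ)`: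
`Decays (A ∘ Γ^{ff} ∘ B) (|Fib d|²·ω_A·C_Γ·ω_B·Zl(δ−δ′)·Zl(δ′−δ″)) δ″` — BOTH oscillations are gained. [folklore] -/
theorem decays_comp_comp_ffKInv {A B : MKer (d + 1) (Fib d)} {CA CΓ CB ωA ωB δ δ' δ'' : ℝ} (hA : Decays A CA δ)
    (hΓ : Decays (blockFF (KInv (N := N) (d := d))) CΓ δ) (hB : Decays B CB δ) (hCB : 0 ≤ CB) (hδ : 0 < δ)
    (hωA : Decays (A - contourRefL N A) ωA δ) (hωB : Decays (B - contourRef N B) ωB δ) (hωB0 : 0 ≤ ωB)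
    (hδ'0 : 0 < δ') (hδ' : δ' < δ) (hδ''0 : 0 ≤ δ'') (hδ'' : δ'' < δ') :
    Decays (comp (comp A (blockFF (KInv (N := N) (d := d)))) B)
      ((Fintype.card (Fib d) : ℝ) * (((Fintype.card (Fib d) : ℝ) * (ωA * CΓ) * Zl (d + 1) (δ - δ')) * ωB) *
        Zl (d + 1) (δ' - δ'')) δ'' := by
  have hΓs : Spr (blockFF (KInv (N := N) (d := d))) := ⟨CΓ, δ, hδ, hΓ⟩
  have hAb : Bdd A CA := bdd_of_decays hA hδ.le
  have hBb : Bdd B CB := bdd_of_decays hB hδ.le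
  refine decays_comp_comp_of_annihil hAb (bdd_contourRefL hAb) hΓ hδ hBb
    ⟨_, δ, hδ, decays_contourRef (N := N) hB hCB hδ.le⟩ ?_ ?_ hωA hωB hωB0 hδ'0 hδ' hδ''0 hδ''
  · exact comp_contourRefL_eq_zero hAb hΓs.tame.2.1 (fun y z κ b => blockFF_inr_left _ y z κ b)
      (fun z b κ u => contourSum_blockFF_KInv_left z b κ u)
  · exact comp_contourRef_eq_zero hΓs.tame.1 hBb (fun x y a κ => blockFF_inr_right _ x y a κ)
      (fun x a κ u => contourSum_blockFF_KInv_right x a κ u)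

end Instance

end Summit.QuantumFields.BalabanUV.Beta.GAN24.WoodburyFibreZeroModeGainKInv

end
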